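import Literature.AlgebraicTopology.SingularHomology.CircleClassPullbackSum
import Literature.AlgebraicTopology.SingularHomology.TorusCohomologyRing
import Literature.AlgebraicTopology.SingularHomology.TorusBettiOne
import HarnessLib

/-!
# The coordinate classes of the torus `(ℝ/ℤ)^ι` (any finite index type): pull-back along
# integer-matrix maps is the transpose, duality with the coordinate loops, basis property

A. Hatcher, *Algebraic Topology* (2002), §3.2 Example 3.16 (`H¹(Tⁿ; R)` is free on the coordinate
classes `ξᵢ = pᵢ^* θ`), §3.C Exercise 11 (`f_A^*` on `H¹` is the transpose matrix), §3.1 p. 198;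
H. Lange, Ch. Birkenhake, *Complex Abelian Varieties* (1992), §1.1.2–1.1.3 (rational representation
of a homomorphism of tori; `H¹(X; ℤ) = Hom(Λ, ℤ)`), eq. (1.2). The tree's `TorusCohomologyRing.lean`
proves `f_A^* ξᵢ = Σⱼ Aᵢⱼ ξⱼ` for the `Fin`-indexed tori `Torus n = Fin n → ℝ/ℤ` and field
coefficients (`map_torusMap_torusXi`). THIS FILE supplies what the complex tori
`ComplexTorus Φ = ι → AddCircle 1` of `Literature/Geometry/Kaehler` (ARBITRARY finite index types
`ι`, maps `ComplexTorus.mapMatrix Φ Φ' A`, `A ∈ M(ι' × ι; ℤ)`) consume: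

* **`map_eval_circleClass_of_matrix`** — for any continuous `f : (ℝ/ℤ)^ι → (ℝ/ℤ)^{ι'}` with
  `f x i' = Σᵢ A i' i • xᵢ` (e.g. `mapMatrix Φ Φ' A`): `f^* ξ'_{i'} = Σᵢ A i' i • ξᵢ` in
  `H¹((ℝ/ℤ)^ι; F)`, `F` a field (from `map_sum_circleClass`, `map_zsmul_circleClass`); the same over
  every commutative ring `R : Type` (`…_of_commRing`, from `CircleClassPullbackSum.lean`); and the
  coordinate-vector form `f^* (Σ_{i'} c_{i'} ξ'_{i'}) = Σᵢ (Aᵀ c)ᵢ ξᵢ`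
  (`map_sum_smul_eval_circleClass_of_matrix`);
* **`kroneckerPairing_eval_circleClass_loopClass_single`** — `⟨ξᵢ, h(γⱼ)⟩ = δᵢⱼ` for the coordinate
  loops `γⱼ(t) = t • eⱼ` (windings `windAlong_eval_coordLoop`; every commutative ring);
* **`linearIndependent_eval_circleClass`** (every commutative ring), `finite_singularCohomology_realTorus`,
  `finrank_singularCohomology_realTorus_one_of_field` (`= |ι|`, every field; transport of
  `TorusCohomology.lean` along the reindexing `ι ≃ Fin |ι|`) and **`span_eval_circleClass_eq_top`**:
  the coordinate classes form a basis of `H¹((ℝ/ℤ)^ι; F)`, in which `f^*` IS the matrix `Aᵀ`.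

Everything is proved; no named facts, no new definitions (coordinate projections are Mathlib's
`ContinuousMap.eval i`, the coordinate loops are `(addCircleLoop 1 0).map (continuous_single j)`, `x ↦ Pi.single j x`).
Consumer: the `H¹`-naturality step of Riemann's theorem on homomorphisms of complex tori /
abelian varieties (Deligne–Milne, LNM 900, II Thm. 6.20) without de Rham theory
(`Literature/Geometry/Kaehler/ComplexTorusMatrixPullback.lean`).

## References

* A. Hatcher, *Algebraic Topology*, CUP 2002, §3.2 Example 3.16, §3.C Exercise 11, §3.1 p. 198.
  [HatcherAT2002]
* H. Lange, Ch. Birkenhake, *Complex Abelian Varieties*, Grundlehren 302, Springer 1992, §1.1.2,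
  §1.1.3, eq. (1.2). [LangeBirkenhake1992]
-/

noncomputable section

open CategoryTheory

universe v

namespace Literature.AlgebraicTopology.SingularHomology

/-! ### Pull-back along integer-matrix maps -/

section MatrixPullback

variable {ι ι' : Type} [Fintype ι]

/-- The `i'`-th coordinate of the integer-matrix map `[A]` is the integral combination
`Σᵢ A i' i • pᵢ` of the coordinate projections, as circle-valued maps. [cite: LangeBirkenhake1992, §1.1.2] -/
theorem eval_comp_eq_sum_zsmul_eval_of_matrix (A : Matrix ι' ι ℤ)
    (f : C(ι → UnitAddCircle, ι' → UnitAddCircle)) (hf : ∀ x i', f x i' = ∑ i, A i' i • x i) (i' : ι') :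
    (ContinuousMap.eval i').comp f =
      ∑ i, A i' i • (ContinuousMap.eval i : C(ι → UnitAddCircle, UnitAddCircle)) := by
  ext x
  simp [hf]

variable (F : Type v) [Field F]

/-- **`[A]^* ξ'_{i'} = Σᵢ A i' i • ξᵢ` in `H¹((ℝ/ℤ)^ι; F)`**, `F` a field: the pull-back of the
coordinate classes `ξ'_{i'} = p_{i'}^* θ` of `(ℝ/ℤ)^{ι'}` along the integer-matrix map
`[A] : x ↦ (i' ↦ Σᵢ A i' i • xᵢ)` (any continuous `f` with this formula, e.g.
`ComplexTorus.mapMatrix Φ Φ' A`) is given by the transpose of `A` on the coordinate classes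
`ξᵢ = pᵢ^* θ` of `(ℝ/ℤ)^ι` (for `Fin`-indexed tori and `f = torusMap A`: `map_torusMap_torusXi`).
[cite: HatcherAT2002, §3.C Exercise 11] [cite: LangeBirkenhake1992, §1.1.2, eq. (1.2)] -/
theorem map_eval_circleClass_of_matrix (A : Matrix ι' ι ℤ)
    (f : C(ι → UnitAddCircle, ι' → UnitAddCircle)) (hf : ∀ x i', f x i' = ∑ i, A i' i • x i) (i' : ι') :
    singularCohomology.map F F f 1
        (singularCohomology.map F F (ContinuousMap.eval i') 1 (circleClass F)) =
      ∑ i, (A i' i : F) •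
        singularCohomology.map F F (ContinuousMap.eval i : C(ι → UnitAddCircle, UnitAddCircle)) 1
          (circleClass F) := by
  rw [singularCohomology.map_map, eval_comp_eq_sum_zsmul_eval_of_matrix A f hf i', map_sum_circleClass]
  refine Finset.sum_congr rfl fun i _ => ?_
  rw [map_zsmul_circleClass, Int.cast_smul_eq_zsmul]

/-- **The transpose on coordinate vectors**: `[A]^* (Σ_{i'} c_{i'} • ξ'_{i'}) = Σᵢ (Aᵀ c)ᵢ • ξᵢ` for
`c : ι' → F` — in the coordinate classes, `H¹([A])` is the matrix `Aᵀ` (Lange–Birkenhake: the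
rational representation acts on `H¹ = Hom(Λ, ℤ)` by the dual). [cite: LangeBirkenhake1992, §1.1.2, eq. (1.2)]
[cite: HatcherAT2002, §3.C Exercise 11] -/
theorem map_sum_smul_eval_circleClass_of_matrix [Fintype ι'] (A : Matrix ι' ι ℤ)
    (f : C(ι → UnitAddCircle, ι' → UnitAddCircle)) (hf : ∀ x i', f x i' = ∑ i, A i' i • x i)
    (c : ι' → F) :
    singularCohomology.map F F f 1
        (∑ i', c i' • (singularCohomology.map F F (ContinuousMap.eval i') 1 (circleClass F) :
          singularCohomology F F (ι' → UnitAddCircle) 1)) =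
      ∑ i, ((A.map (Int.cast : ℤ → F)).transpose.mulVec c) i •
        (singularCohomology.map F F (ContinuousMap.eval i : C(ι → UnitAddCircle, UnitAddCircle)) 1
          (circleClass F) : singularCohomology F F (ι → UnitAddCircle) 1) := by
  rw [map_sum]
  simp only [map_smul, map_eval_circleClass_of_matrix F A f hf, Finset.smul_sum, smul_smul]
  rw [Finset.sum_comm]
  refine Finset.sum_congr rfl fun i _ => ?_
  rw [← Finset.sum_smul, Matrix.mulVec_transpose, Matrix.vecMul, dotProduct]
  simp only [Matrix.map_apply]

variable (R : Type) [CommRing R]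

/-- **`[A]^* ξ'_{i'} = Σᵢ A i' i • ξᵢ` in `H¹((ℝ/ℤ)^ι; R)` for EVERY commutative coefficient ring `R`**
(in particular `R = ℤ`: the integral statement `H¹(f) = ᵗρᵣ(f)` of Lange–Birkenhake §1.1.3), from the
integral additivity of `θ`-pull-backs on the path-connected torus (`map_sum_zsmul_circleClass_of_commRing`).
[cite: LangeBirkenhake1992, §1.1.2, §1.1.3, eq. (1.2)] [cite: HatcherAT2002, §3.C Exercise 11] -/
theorem map_eval_circleClass_of_matrix_of_commRing (A : Matrix ι' ι ℤ)
    (f : C(ι → UnitAddCircle, ι' → UnitAddCircle)) (hf : ∀ x i', f x i' = ∑ i, A i' i • x i) (i' : ι') :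
    singularCohomology.map R R f 1
        (singularCohomology.map R R (ContinuousMap.eval i') 1 (circleClass R)) =
      ∑ i, (A i' i : R) •
        singularCohomology.map R R (ContinuousMap.eval i : C(ι → UnitAddCircle, UnitAddCircle)) 1
          (circleClass R) := by
  rw [singularCohomology.map_map, eval_comp_eq_sum_zsmul_eval_of_matrix A f hf i',
    map_sum_zsmul_circleClass_of_commRing R Finset.univ (fun i => A i' i)
      (fun i => (ContinuousMap.eval i : C(ι → UnitAddCircle, UnitAddCircle)))]

end MatrixPullback

/-! ### The coordinate classes are dual to the coordinate loops; independence and spanning -/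

section CoordinateBasis

variable {ι : Type} [Fintype ι] [DecidableEq ι]

open Literature.AlgebraicTopology.FundamentalGroup (addCircleLoop addCircleLoop_apply)

omit [Fintype ι] in
/-- **The winding of the `i`-th coordinate along the `j`-th coordinate loop is `δᵢⱼ`**: along
`γⱼ(t) = t • eⱼ` the coordinate `pᵢ` is the fundamental loop of `ℝ/ℤ` (lift `t ↦ t`) if `i = j`
and constant (lift `0`) otherwise. [cite: HatcherAT2002, §3.2 Example 3.16] -/
theorem windAlong_eval_coordLoop (i j : ι) :
    windAlong (ContinuousMap.eval i : C(ι → UnitAddCircle, UnitAddCircle))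
        ((addCircleLoop (1 : ℝ) 0).map (continuous_single (A := fun _ : ι => UnitAddCircle) j)) =
      if i = j then 1 else 0 := by
  by_cases h : i = j
  · subst h
    rw [if_pos rfl, windAlong, liftIncrement_eq_of_lift _ ⟨fun t => (t : ℝ), continuous_subtype_val⟩
      (fun t => by
        rw [Path.map_coe, Function.comp_apply]
        simp [addCircleLoop_apply])]
    simp
  · rw [if_neg h, windAlong_eq_of_lift (ContinuousMap.eval i : C(ι → UnitAddCircle, UnitAddCircle))
      _ (S := {z | z i = 0}) (F := fun _ => 0) continuousOn_const
      (fun z hz => by rw [QuotientAddGroup.mk_zero]; exact (Set.mem_setOf_eq ▸ hz).symm)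
      (fun t => by simp [Pi.single_eq_of_ne h]), sub_self]

omit [Fintype ι] in
/-- The integer winding `W_{pᵢ}(h(γⱼ)) = δᵢⱼ`. [cite: HatcherAT2002, §3.2 Example 3.16] -/
theorem windingFunctional_eval_coordLoop (i j : ι) :
    windingFunctional (ContinuousMap.eval i : C(ι → UnitAddCircle, UnitAddCircle))
        (loopClass ℤ ℤ (1 : ℤ) ((addCircleLoop (1 : ℝ) 0).map (continuous_single (A := fun _ : ι => UnitAddCircle) j))) =
      if i = j then 1 else 0 := by
  have h := windAlong_eval_coordLoop i j
  rw [← windingFunctional_loopClass] at h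
  split_ifs at h ⊢ <;> exact_mod_cast h

variable (R : Type v) [CommRing R]

omit [Fintype ι] in
/-- **`⟨ξᵢ, h(γⱼ)⟩ = δᵢⱼ`**: the coordinate classes `ξᵢ = pᵢ^* θ` of `H¹((ℝ/ℤ)^ι; R)` and the
Hurewicz classes of the coordinate loops `γⱼ(t) = t • eⱼ` are dual families under the Kronecker
pairing, for every commutative ring `R`. [cite: HatcherAT2002, §3.2 Example 3.16] -/
theorem kroneckerPairing_eval_circleClass_loopClass_single (i j : ι) :
    kroneckerPairing R R (ι → UnitAddCircle) 1
        (singularCohomology.map R R (ContinuousMap.eval i : C(ι → UnitAddCircle, UnitAddCircle)) 1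
          (circleClass R))
        (loopClass R R (1 : R) ((addCircleLoop (1 : ℝ) 0).map (continuous_single (A := fun _ : ι => UnitAddCircle) j))) =
      if i = j then 1 else 0 := by
  rw [kroneckerPairing_map_circleClass_loopClass, windingFunctional_eval_coordLoop]
  split_ifs <;> simp

/-- **The coordinate classes `ξᵢ`, `i ∈ ι`, are linearly independent in `H¹((ℝ/ℤ)^ι; R)`** over
every commutative ring `R` (pair a vanishing combination with the coordinate loops).
[cite: HatcherAT2002, §3.2 Example 3.16] -/
theorem linearIndependent_eval_circleClass :
    LinearIndependent R fun i : ι =>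
      (singularCohomology.map R R (ContinuousMap.eval i : C(ι → UnitAddCircle, UnitAddCircle)) 1
        (circleClass R) : singularCohomology R R (ι → UnitAddCircle) 1) := by
  rw [Fintype.linearIndependent_iff]
  intro g hg j
  have h := congrArg (fun x => kroneckerPairing R R (ι → UnitAddCircle) 1 x
    (loopClass R R (1 : R) ((addCircleLoop (1 : ℝ) 0).map (continuous_single (A := fun _ : ι => UnitAddCircle) j)))) hg
  simp only [map_sum, map_smul, LinearMap.sum_apply, LinearMap.smul_apply,
    kroneckerPairing_eval_circleClass_loopClass_single, smul_eq_mul, mul_ite, mul_one, mul_zero,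
    Finset.sum_ite_eq', Finset.mem_univ, if_true, map_zero, LinearMap.zero_apply] at h
  exact h

omit [DecidableEq ι] in
/-- `Hᵏ((ℝ/ℤ)^ι; F)` is finite-dimensional over a field `F` (transport of
`finite_singularCohomology_torus` along the reindexing homeomorphism `(ℝ/ℤ)^ι ≃ (ℝ/ℤ)^{|ι|}`).
[cite: HatcherAT2002, §3.2 Example 3.16] -/
theorem finite_singularCohomology_realTorus (F : Type v) [Field F] (k : ℕ) :
    Module.Finite F (singularCohomology F F (ι → UnitAddCircle) k) := by
  haveI := finite_singularCohomology_torus F (Fintype.card ι) k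
  exact Module.Finite.equiv (singularCohomology.mapIso F F
    (Homeomorph.piCongrLeft (Y := fun _ : Fin (Fintype.card ι) => UnitAddCircle)
      (Fintype.equivFin ι)) k).toLinearEquiv

omit [DecidableEq ι] in
/-- **`dim_F H¹((ℝ/ℤ)^ι; F) = |ι|`** for every field `F` (transport of
`finrank_singularCohomology_torus`; the case `F = ℚ` is `finrank_singularCohomology_realTorus_one`).
[cite: HatcherAT2002, §3.2 Example 3.16] -/
theorem finrank_singularCohomology_realTorus_one_of_field (F : Type v) [Field F] :
    Module.finrank F (singularCohomology F F (ι → UnitAddCircle) 1) = Fintype.card ι := by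
  rw [← (singularCohomology.mapIso F F
    (Homeomorph.piCongrLeft (Y := fun _ : Fin (Fintype.card ι) => UnitAddCircle)
      (Fintype.equivFin ι)) 1).toLinearEquiv.finrank_eq, finrank_singularCohomology_torus,
    Nat.choose_one_right]

/-- **Over a field the coordinate classes span `H¹((ℝ/ℤ)^ι; F)`** (`|ι|` independent vectors in a
space of dimension `|ι|`); with `linearIndependent_eval_circleClass` they form a basis, in which
`[A]^*` is the matrix `Aᵀ` (`map_eval_circleClass_of_matrix`). [cite: HatcherAT2002, §3.2 Example 3.16] -/
theorem span_eval_circleClass_eq_top (F : Type v) [Field F] :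
    Submodule.span F (Set.range fun i : ι =>
      (singularCohomology.map F F (ContinuousMap.eval i : C(ι → UnitAddCircle, UnitAddCircle)) 1
        (circleClass F) : singularCohomology F F (ι → UnitAddCircle) 1)) = ⊤ := by
  haveI : Module.Finite F (singularCohomology F F (ι → UnitAddCircle) 1) :=
    finite_singularCohomology_realTorus F 1
  exact (linearIndependent_eval_circleClass (ι := ι) F).span_eq_top_of_card_eq_finrank'
    (finrank_singularCohomology_realTorus_one_of_field (ι := ι) F).symm

end CoordinateBasis

end Literature.AlgebraicTopology.SingularHomology

end
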